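import Literature.Computability.Complexity.PlethysmStabilityBIP
import Literature.Computability.AlgebraicComplexity.HwvIdealDegreeCriterion
import HarnessLib

/-!
# At most `d` rows in `Sym^d Sym^n V`: the plethysm coefficient `a_λ(d[n])` vanishes for
# `ℓ(λ) > d`

Topic `Literature/Computability/AlgebraicComplexity`, a sibling of `PlethysmFirstRowVanishing.lean`
(GIP Prop. 13: `a_λ(d[n]) = 0` for `λ₁ < n`) with the same method and conventions
(`PlethysmStability.lean`: the word model `wordRep k N (D m)` of `V^{⊗ Dm}`, `V = k^N`, positions
`Fin (D * m)` in `D` blocks of `m` (`blockIdx`), the wreath product `S_D ≀ S_m = blockPerms D m`, its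
unnormalised symmetriser `Σ = blockSymmetrizer k D m`, standard fillings `T : StdFilling (D m) Y` and
their polytabloids `e_T`; BIP (4.1) `Sym^D Sym^m V = (⊗^{Dm} V)^{S_D ≀ S_m}` and BIP Prop. 3.3 /
Prop. 4.5: the invariant highest-weight vectors of weight `λ` — counted by `a_λ(D[m])` — are
spanned by the `Σ e_T`, `T` standard of shape `λ`).

## Result

**The classical length bound** — "`s_λ ∘ h_n = Σ_μ (…) s_μ`, the outer sum being over partitions
`μ` such that `|μ| = n|λ|` and `ℓ(μ) ≤ |λ|`" [Macdonald, I.8 Example 9, for `λ = (d)`: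
`h_d ∘ h_n`]; "by Young's rule, `s_(n)` is a summand of `s_(1)^n`, so the plethysm
`s_(n) ∘ s_(m)` is contained in `s_(m)^n`. Another application of Young's rule now shows that if
`s_λ` is a constituent of `s_(n) ∘ s_(m)` then `ℓ(λ) ≤ n`" [de Boeck–Paget–Wildon 2021, §1] —
i.e. **`a_λ(d[n]) = 0` whenever `ℓ(λ) > d`**, proved here by the pigeonhole of the sibling file run
on the first COLUMN instead of the first row:

1. `StdFilling.blockSymmetrizer_polytabloid_eq_zero_of_lt_rows`: if `Y` has more than `D` rows
   (cells `(i, 0)`, `i < L`, with `D < L`), then for EVERY standard filling `T` of `Y` by the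
   `D m` positions two cells of column `0` carry positions of the same block (pigeonhole: `D`
   blocks), so `Σ e_T = 0` by BIP Lemma 4.3(1) (`StdFilling.blockSymmetrizer_polytabloid_eq_zero`:
   "If the same letter appears in a column of `T` more than once, then `v_T = 0`").
2. `eq_zero_of_mem_highestWeightSpace_wordRep_of_lt_rows`: hence the word model of `V^{⊗ Dm}` has
   no nonzero `S_D ≀ S_m`-invariant highest-weight vector of weight `λ = ydWeight N Y`
   (`|S_D ≀ S_m| · x = ∑_T a_T Σ e_T = 0`, BIP Prop. 3.3 in basis form): `HWV_λ(Sym^D Sym^m V) = 0`.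
3. `eq_zero_of_mem_highestWeightSpace_coordRep_of_lt_card_parts`: through the polarisation
   dictionary `wordOfForm` (`PlethysmStability.lean` §5), `k[Sym^n (k^σ)]_d` has no nonzero
   highest-weight vector of `coordRep` of the dual weight `λ^*` when `ℓ(λ) > d` (characteristic
   zero); subspace form `highestWeightSpace_coordRep_eq_bot_of_lt_card_parts`; numerically, on the
   matrix space `V = k^{m²}` of the homogeneous setting,
   `plethysmCoeff_dualOfPartition_eq_zero_of_lt_card_parts`: `a_λ(d[n]) = 0` for `ℓ(λ) > d`
   (`λ ⊢ n d`, at most `m²` parts — the side condition of the truncating `Weight.dualOfPartition`).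
4. Use (the reason this file exists — the low-degree ideal census of an orbit closure
   `Δ_n[f] ⊂ Sym^n k^{m²}`, `HwvIdealDegreeCriterion.lean`): in the partition-indexed criterion
   "`I(Δ_n[f])_d = 0` iff `a_{λ*} ≤ mult_{λ*}` for every `λ ⊢ n d`" the partitions with more than
   `d` parts may be SKIPPED (`orbitVanishingIdeal_degree_eq_zero_of_forall_partition_card_le`, and
   the `det_m` / padded-permanent instances): their `a_λ` is `0`.

5. (addendum, `§6`) **Degree monotonicity**: `I(Δ_m[f])` is an ideal of the domain `k[Sym^m]`, so
   emptiness in degree `d` descends to every degree `d' ≤ d`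
   (`orbitVanishingIdeal_degree_eq_zero_of_le`, `orbitVanishingIdeal_eq_zero_below_of_pred`); hence
   the packet sentence "the minimal degree of `I(Ω_m)` is `D`" needs the census in degree `D - 1`
   ONLY (`orbitVanishingIdeal_det_eq_zero_below_and_exists_of_pred_of_symKroneckerCoeffRect_lt`,
   per-side twin `orbitVanishingIdeal_paddedPer_eq_zero_below_of_pred`); lower-degree censuses are
   cross-checks, not hypotheses. Conversely non-emptiness ascends (`§7`,
   `exists_ne_zero_mem_orbitVanishingIdeal_of_le`), so under those hypotheses `I(Ω_m)_d ≠ 0 ⇔ d ≥ D`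
   (`exists_ne_zero_mem_orbitVanishingIdeal_det_iff_le_of_pred_of_symKroneckerCoeffRect_lt`).

## References

* I. G. Macdonald, *Symmetric Functions and Hall Polynomials*, 2nd ed., OUP 1995, Ch. I §8,
  Example 9 ("`ℓ(μ) ≤ |λ|`"), Example 6(d). [key `Macdonald1995`]
* M. de Boeck, R. Paget, M. Wildon, *Plethysms of symmetric functions and highest weight
  representations*, Trans. AMS 374 (2021) 8013–8043 = arXiv:1810.03448, §1 ("if `s_λ` is a
  constituent of `s_(n) ∘ s_(m)` then `ℓ(λ) ≤ n`"; Newell's identities). [key `DeboeckPagetWildon2021`]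
* P. Bürgisser, C. Ikenmeyer, G. Panova, *No occurrence obstructions in geometric complexity
  theory*, J. AMS 32 (2019) = arXiv:1604.06431v3: §3(b) Prop. 3.3, §4 (4.1), Lemma 4.3(1),
  Prop. 4.5. [key `BurgisserIkenmeyerPanovaJAMS2019`]

## Mathlib and tree

Mathlib: `Finset.exists_ne_map_eq_of_card_lt_of_maps_to` (pigeonhole). Tree (`PlethysmStability`,
`PlethysmStabilityBIP`, `StandardFillings`, `PartitionTableaux`, `HwvIdealDegreeCriterion`):
`blockIdx`, `StdFilling.blockSymmetrizer_polytabloid_eq_zero` (Lemma 4.3(1)), `StdFilling.exists_eq`,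
`exists_sum_smul_polytabloid_eq`, `blockSymmetrizer_apply_of_forall_wordPerm_eq`,
`card_blockPermsFinset_pos`, `wordOfForm`, `wordOfForm_mem_highestWeightSpace`,
`wordPerm_wordOfForm`, `eq_of_wordOfForm_eq`, `ydWeight_youngDiagram`,
`Nat.Partition.mem_youngDiagram_iff`, `fst_lt_of_mem_youngDiagram`, `revMatIdx`,
`neg_partitionWeightLex_revMatIdx`, `isHomogeneous_of_mem_highestWeightSpace`,
`orbitVanishingIdeal_degree_eq_zero_of_forall_partition`. No new definitions, no named facts.
-/

open scoped BigOperators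

namespace Literature.Computability.AlgebraicComplexity

open _root_.Literature.NumberTheory.DiophantineGeometry
open Literature.Computability.Complexity (revMatIdx strictAnti_revMatIdx
  neg_partitionWeightLex_revMatIdx partitionWeightLex)

/-! ### 1. The pigeonhole: two cells of column `0` in one block -/

section WordModel

variable {k : Type*} [Field k] [CharZero k] {N D m : ℕ} {Y : YoungDiagram}

/-- **More rows than blocks ⇒ `Σ e_T = 0` for every standard filling.** If the cells
`(0,0), (1,0), …, (L-1,0)` all belong to `Y` with `D < L`, and `T` is a standard filling of `Y`
by the `D m` positions (`|Y| = D m`), then two of these cells of column `0` carry positions of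
one block (pigeonhole over the `D` blocks), and BIP Lemma 4.3(1) gives `Σ e_T = 0`. This is the
column version of GIP's pigeonhole for Prop. 13 (sibling file). Macdonald I.8 Ex. 9;
dBPW21 §1. [cite: BurgisserIkenmeyerPanovaJAMS2019, Lemma 4.3 (1)] -/
theorem _root_.Literature.NumberTheory.DiophantineGeometry.StdFilling.blockSymmetrizer_polytabloid_eq_zero_of_lt_rows
    (hN : ∀ x ∈ Y.cells, x.1 < N) (hd : Y.cells.card = D * m) (T : StdFilling (D * m) Y)
    {L : ℕ} (hrows : ∀ i < L, (i, 0) ∈ Y) (hL : D < L) :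
    blockSymmetrizer k D m (T.polytabloid k hN) = 0 := by
  classical
  -- a position for each of the `L` cells of column `0`
  have hex : ∀ i : Fin L, ∃ p : Fin (D * m), T.1 p = ((i : ℕ), 0) :=
    fun i => T.exists_eq hd (hrows i i.isLt)
  choose pos hpos using hex
  have hmaps : ∀ i ∈ (Finset.univ : Finset (Fin L)),
      blockIdx D m (pos i) ∈ (Finset.univ : Finset (Fin D)) := fun _ _ => Finset.mem_univ _
  have hcard : (Finset.univ : Finset (Fin D)).card < (Finset.univ : Finset (Fin L)).card := by
    rw [Finset.card_univ, Finset.card_univ, Fintype.card_fin, Fintype.card_fin]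
    exact hL
  obtain ⟨i, -, j, -, hij, hblk⟩ := Finset.exists_ne_map_eq_of_card_lt_of_maps_to hcard hmaps
  have hne : pos i ≠ pos j := by
    intro h
    apply hij
    have h1 : ((i : ℕ), 0) = ((j : ℕ), 0) := by rw [← hpos i, ← hpos j, h]
    exact Fin.ext (Prod.mk.inj h1).1
  have hcol : (T.1 (pos i)).2 = (T.1 (pos j)).2 := by rw [hpos i, hpos j]
  exact T.blockSymmetrizer_polytabloid_eq_zero hN hne hcol hblk

/-- **No wreath-invariant highest-weight vectors with more than `D` rows in the word model.**
If `|Y| = D m`, `Y` has fewer than `N` rows but more than `D` of them (cells `(i,0)`, `i < L`,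
`D < L`), then every `S_D ≀ S_m`-invariant highest-weight vector `x` of weight `λ = ydWeight N Y`
of the word model of `V^{⊗ Dm}` vanishes: `|S_D ≀ S_m| · x = Σ x = ∑_T a_T Σ e_T = 0` over the
standard fillings (BIP Prop. 3.3 in basis form), characteristic zero. That is,
`HWV_λ(Sym^D Sym^m V) = 0`: the plethysm coefficient `a_λ(D[m])` vanishes for `ℓ(λ) > D`
("if `s_λ` is a constituent of `s_(n) ∘ s_(m)` then `ℓ(λ) ≤ n`", dBPW21 §1; Macdonald I.8 Ex. 9).
[cite: BurgisserIkenmeyerPanovaJAMS2019, Prop. 3.3 and Lemma 4.3 (1)] -/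
theorem eq_zero_of_mem_highestWeightSpace_wordRep_of_lt_rows
    (hN : ∀ x ∈ Y.cells, x.1 < N) (hd : Y.cells.card = D * m)
    {L : ℕ} (hrows : ∀ i < L, (i, 0) ∈ Y) (hL : D < L)
    {x : Word N (D * m) → k} (hx : x ∈ highestWeightSpace (wordRep k N (D * m)) (ydWeight N Y))
    (hinv : ∀ τ ∈ blockPerms D m, wordPerm k τ x = x) : x = 0 := by
  classical
  obtain ⟨a, ha⟩ := exists_sum_smul_polytabloid_eq hN hd hx
  have hS : (blockPermsFinset D m).card • x =
      ∑ T, a T • blockSymmetrizer k D m (T.polytabloid k hN) := by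
    rw [← blockSymmetrizer_apply_of_forall_wordPerm_eq k hinv, ← ha, map_sum]
    simp_rw [map_smul]
  have h0 : (blockPermsFinset D m).card • x = 0 := by
    rw [hS]
    exact Finset.sum_eq_zero fun T _ => by
      rw [T.blockSymmetrizer_polytabloid_eq_zero_of_lt_rows hN hd hrows hL, smul_zero]
  rw [← Nat.cast_smul_eq_nsmul k] at h0
  exact (smul_eq_zero.mp h0).resolve_left (Nat.cast_ne_zero.mpr card_blockPermsFinset_pos.ne')

end WordModel

/-! ### 2. Back to `k[Sym^n]_d`: no highest-weight vectors of dual weight `λ^*` with `ℓ(λ) > d` -/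

section Polynomials

open MvPolynomial

variable {k : Type*} [Field k] [CharZero k] {σ : Type*} [LinearOrder σ] [Fintype σ] {M : ℕ}
  {n d : ℕ}

/-- The rows of the Young diagram of a partition: `(i, 0)` is a cell iff `i < ℓ(λ)`. [folklore] -/
theorem mk_zero_mem_youngDiagram_iff {s : ℕ} (lam : Nat.Partition s) (i : ℕ) :
    (i, 0) ∈ lam.youngDiagram ↔ i < lam.parts.card := by
  rw [Nat.Partition.mem_youngDiagram_iff, ← Nat.Partition.length_sortedParts]
  exact ⟨fun ⟨h, _⟩ => h, fun h => ⟨h, lam.pos_of_mem_sortedParts (List.getElem_mem h)⟩⟩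

/-- A partition of `s` has at most `s` parts (each part is `≥ 1`). [folklore] -/
theorem card_parts_le_self {s : ℕ} (lam : Nat.Partition s) : lam.parts.card ≤ s := by
  have h : lam.parts.card • 1 ≤ lam.parts.sum :=
    (Multiset.card_nsmul_le_sum fun x hx => lam.parts_pos hx)
  simpa [lam.parts_sum] using h

/-- **No highest-weight vectors with more than `d` rows among the forms of degree `d` on
`Sym^n (k^σ)`** (plethysm coefficients `a_λ(d[n]) = 0` for `ℓ(λ) > d`). Let `ρ : Fin M ≃ σ` be
order-reversing and `λ ⊢ s = d·n` a partition with at most `M` parts and MORE than `d` parts.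
Then every form `h` of degree `d` on `Sym^n (k^σ)` which is a highest-weight vector of `coordRep`
of weight `χ` with `-χ(ρ i) = λ_{i+1}` (i.e. `χ = λ^*` read through `ρ`) is zero: its transported
polarisation `wordOfForm ρ n d h` is an `S_d ≀ S_n`-invariant highest-weight vector of weight `λ`
of the word model (`wordOfForm_mem_highestWeightSpace`, `wordPerm_wordOfForm`), hence zero
(`eq_zero_of_mem_highestWeightSpace_wordRep_of_lt_rows`), and the polarisation is injective
(`eq_of_wordOfForm_eq`). Characteristic zero. Macdonald I.8 Ex. 9 ("`ℓ(μ) ≤ |λ|`");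
dBPW21 §1. [cite: BurgisserIkenmeyerPanovaJAMS2019, Prop. 3.3 and Lemma 4.3 (1)] -/
theorem eq_zero_of_mem_highestWeightSpace_coordRep_of_lt_card_parts {ρ : Fin M ≃ σ}
    (hρ : StrictAnti ρ) {s : ℕ} (hs : s = d * n) (lam : Nat.Partition s)
    (hlam : lam.parts.card ≤ M) (hlen : d < lam.parts.card)
    {h : MvPolynomial (DegIdx σ n) k} (hh : h.IsHomogeneous d) {χ : Weight σ}
    (hχ : ∀ i, -χ (ρ i) = Weight.ofPartition M lam i)
    (hhw : h ∈ highestWeightSpace (coordRep σ k n) χ) : h = 0 := by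
  classical
  subst hs
  set Y := lam.youngDiagram with hY
  have hN : ∀ x ∈ Y.cells, x.1 < M := fun x hx =>
    Literature.NumberTheory.DiophantineGeometry.fst_lt_of_mem_youngDiagram lam hlam hx
  have hd : Y.cells.card = d * n := lam.card_cells_youngDiagram
  have hrows : ∀ i < lam.parts.card, (i, 0) ∈ Y := fun i hi => by
    rw [hY, mk_zero_mem_youngDiagram_iff]
    exact hi
  have hx : wordOfForm ρ n d h ∈ highestWeightSpace (wordRep k M (d * n)) (ydWeight M Y) := by
    have := wordOfForm_mem_highestWeightSpace hρ hh hhw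
    rwa [show (fun i => -χ (ρ i)) = ydWeight M Y from by
      rw [hY, Literature.NumberTheory.DiophantineGeometry.ydWeight_youngDiagram]
      funext i
      exact hχ i] at this
  have hinv : ∀ τ ∈ blockPerms d n, wordPerm k τ (wordOfForm ρ n d h) = wordOfForm ρ n d h :=
    fun τ hτ => wordPerm_wordOfForm ρ h hτ
  have hx0 : wordOfForm ρ n d h = 0 :=
    eq_zero_of_mem_highestWeightSpace_wordRep_of_lt_rows hN hd hrows hlen hx hinv
  refine eq_of_wordOfForm_eq ρ hh (isHomogeneous_zero _ _ _) ?_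
  rw [hx0]
  funext w
  rw [Pi.zero_apply, wordOfForm_apply, polarize, arrOf, coeff_zero, zero_div]

/-- The same in subspace form: for `λ ⊢ s = d·n` with at most `M` and more than `d` parts, the
highest-weight space of `coordRep σ k n` of a weight `χ` with `-χ(ρ i) = λ_{i+1}` of size `-(n d)`
is `⊥` ("a weight pins the degree", `isHomogeneous_of_mem_highestWeightSpace`; `n ≠ 0` because
`d < ℓ(λ) ≤ |λ| = d n`) — `HWV_{λ}(Sym^d Sym^n V) = 0`, `a_λ(d[n]) = 0` for `ℓ(λ) > d`.
Method: BIP Prop. 3.3 + Lemma 4.3(1); statement: Macdonald I.8 Ex. 9, dBPW21 §1.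
[cite: Macdonald1995, Ch. I §8 Example 9] -/
theorem highestWeightSpace_coordRep_eq_bot_of_lt_card_parts {ρ : Fin M ≃ σ} (hρ : StrictAnti ρ)
    {s : ℕ} (hs : s = d * n) (lam : Nat.Partition s) (hlam : lam.parts.card ≤ M)
    (hlen : d < lam.parts.card) {χ : Weight σ}
    (hχ : ∀ i, -χ (ρ i) = Weight.ofPartition M lam i)
    (hsize : χ.size = -((n * d : ℕ) : ℤ)) :
    highestWeightSpace (coordRep σ k n) χ = ⊥ := by
  have hn : n ≠ 0 := by
    rintro rfl
    have := card_parts_le_self lam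
    omega
  rw [Submodule.eq_bot_iff]
  intro h hh
  exact eq_zero_of_mem_highestWeightSpace_coordRep_of_lt_card_parts hρ hs lam hlam hlen
    (isHomogeneous_of_mem_highestWeightSpace hn hh hsize) hχ hh

end Polynomials

/-! ### 3. On the matrix space `V = k^{m²}`: `a_λ(d[n]) = 0` for `ℓ(λ) > d` -/

section MatIdx

variable {k : Type} [Field k] [CharZero k]

/-- **`a_λ(d[n]) = 0` for `ℓ(λ) > d`, numerically, in the convention of the obstruction files**
(`λ^* = (Weight.dualOfPartition (m·m) λ).toMatIdx = partitionWeightLex m λ` on the lexicographic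
matrix variables `MatIdx m`): for `λ ⊢ s = d·n` with at most `m²` parts and more than `d` parts,
`plethysmCoeff k (MatIdx m) n λ^* = 0`. Macdonald I.8 Ex. 9 ("the outer sum being over partitions
`μ` such that `|μ| = n|λ|` and `ℓ(μ) ≤ |λ|`"); dBPW21 §1 ("if `s_λ` is a constituent of
`s_(n) ∘ s_(m)` then `ℓ(λ) ≤ n`"); method: BIP Prop. 3.3 + Lemma 4.3(1) as in §1–§2.
[cite: Macdonald1995, Ch. I §8 Example 9] -/
theorem plethysmCoeff_dualOfPartition_eq_zero_of_lt_card_parts {n m d s : ℕ} (hs : s = d * n)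
    (lam : Nat.Partition s) (hlam : lam.parts.card ≤ m * m) (hlen : d < lam.parts.card) :
    plethysmCoeff k (MatIdx m) n (Weight.dualOfPartition (m * m) lam).toMatIdx = 0 := by
  have hsize : ((Weight.dualOfPartition (m * m) lam).toMatIdx : Weight (MatIdx m)).size =
      -((n * d : ℕ) : ℤ) := by
    rw [Weight.size_toMatIdx, Weight.dualOfPartition, Weight.size_dual,
      Weight.size_ofPartition_holds hlam, hs, mul_comm]
  rw [plethysmCoeff, Literature.NumberTheory.DiophantineGeometry.hwMultiplicity,
    highestWeightSpace_coordRep_eq_bot_of_lt_card_parts (strictAnti_revMatIdx m) hs lam hlam hlen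
      (neg_partitionWeightLex_revMatIdx m lam) hsize, finrank_bot]

/-! ### 4. The low-degree ideal census may skip the partitions with more than `d` parts -/

/-- **Partition-indexed criterion for `I(Δ_m[f])_d = 0`, long partitions skipped** (the
homogeneous setting of the obstruction files: forms of degree `m` on the `m²` lexicographic matrix
variables, characteristic zero). If for every partition `λ ⊢ m d` with at most `min(m², d)` parts
a certificate gives `a_{λ*} ≤ mult_{λ*} k[Δ_m[f]]`, then `I(Δ_m[f])_d = 0` — the partitions with
more than `d` parts have `a_{λ*} = 0` (`plethysmCoeff_dualOfPartition_eq_zero_of_lt_card_parts`)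
and need no certificate (`orbitVanishingIdeal_degree_eq_zero_of_forall_partition`). Macdonald
I.8 Ex. 9; BLMW (5.2.2). [cite: BLMW2011, (5.2.2)] -/
theorem orbitVanishingIdeal_degree_eq_zero_of_forall_partition_card_le {m : ℕ} [NeZero m]
    {f : MvPolynomial (MatIdx m) k} (hf : f.IsHomogeneous m) {d : ℕ}
    (H : ∀ lam : Nat.Partition (m * d), lam.parts.card ≤ m * m → lam.parts.card ≤ d →
      plethysmCoeff k (MatIdx m) m (Weight.dualOfPartition (m * m) lam).toMatIdx ≤
        orbitMultiplicity k f m (Weight.dualOfPartition (m * m) lam).toMatIdx)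
    {Ψ : MvPolynomial (DegIdx (MatIdx m) m) k} (hΨI : Ψ ∈ orbitVanishingIdeal f m)
    (hΨd : Ψ.IsHomogeneous d) : Ψ = 0 := by
  have H' : ∀ lam : Nat.Partition (m * d), lam.parts.card ≤ m * m →
      plethysmCoeff k (MatIdx m) m (Weight.dualOfPartition (m * m) lam).toMatIdx ≤
        orbitMultiplicity k f m (Weight.dualOfPartition (m * m) lam).toMatIdx := by
    intro lam hlam
    by_cases hlen : lam.parts.card ≤ d
    · exact H lam hlam hlen
    · have h0 : plethysmCoeff k (MatIdx m) m (Weight.dualOfPartition (m * m) lam).toMatIdx = 0 :=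
        plethysmCoeff_dualOfPartition_eq_zero_of_lt_card_parts (mul_comm m d) lam hlam
          (not_le.mp hlen)
      rw [h0]
      exact Nat.zero_le _
  exact orbitVanishingIdeal_degree_eq_zero_of_forall_partition hf H' hΨI hΨd

/-- **Tranche 1c-i shape with long partitions skipped: `I(Δ(det_m))_d = 0`** from one det-side
certificate `a ≤ mult` per partition `λ ⊢ m d` with `ℓ(λ) ≤ min(m², d)`.
Macdonald I.8 Ex. 9; BLMW (5.2.2). [cite: BLMW2011, (5.2.2)] -/
theorem orbitVanishingIdeal_det_degree_eq_zero_of_forall_partition_card_le {m : ℕ} [NeZero m]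
    {d : ℕ}
    (H : ∀ lam : Nat.Partition (m * d), lam.parts.card ≤ m * m → lam.parts.card ≤ d →
      plethysmCoeff k (MatIdx m) m (Weight.dualOfPartition (m * m) lam).toMatIdx ≤
        orbitMultiplicity k (detFormLex k m) m (Weight.dualOfPartition (m * m) lam).toMatIdx)
    {Ψ : MvPolynomial (DegIdx (MatIdx m) m) k} (hΨI : Ψ ∈ orbitVanishingIdeal (detFormLex k m) m)
    (hΨd : Ψ.IsHomogeneous d) : Ψ = 0 :=
  orbitVanishingIdeal_degree_eq_zero_of_forall_partition_card_le (detFormLex_isHomogeneous k m) H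
    hΨI hΨd

/-- **Tranche 1c-ii shape with long partitions skipped: `I(Δ(z^{m-n} per_n))_d = 0`** (padded
permanent, `n ≤ m`) from one per-side certificate `a ≤ r_per ≤ mult` per partition `λ ⊢ m d` with
`ℓ(λ) ≤ min(m², d)`. Macdonald I.8 Ex. 9; BLMW (5.2.2). [cite: BLMW2011, (5.2.2)] -/
theorem orbitVanishingIdeal_paddedPer_degree_eq_zero_of_forall_partition_card_le {n m : ℕ}
    [NeZero m] (hnm : n ≤ m) {d : ℕ}
    (H : ∀ lam : Nat.Partition (m * d), lam.parts.card ≤ m * m → lam.parts.card ≤ d →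
      plethysmCoeff k (MatIdx m) m (Weight.dualOfPartition (m * m) lam).toMatIdx ≤
        orbitMultiplicity k (paddedPerFormLex k n m) m (Weight.dualOfPartition (m * m) lam).toMatIdx)
    {Ψ : MvPolynomial (DegIdx (MatIdx m) m) k}
    (hΨI : Ψ ∈ orbitVanishingIdeal (paddedPerFormLex k n m) m) (hΨd : Ψ.IsHomogeneous d) :
    Ψ = 0 :=
  orbitVanishingIdeal_degree_eq_zero_of_forall_partition_card_le
    (paddedPerFormLex_isHomogeneous (k := k) hnm) H hΨI hΨd

/-! ### 5. The packet sentence: `I(Δ(det_m))` is zero below degree `D` and nonzero in degree `D` -/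

/-- **Shape of 'the minimal degree of the ideal of `Ω_m = Δ(det_m)` is `D`'.** If for every degree
`d < D` and every partition `λ ⊢ m d` with `ℓ(λ) ≤ min(m², d)` a det-side certificate gives
`a_{λ*} ≤ mult_{λ*} k[Ω_m]_d` (so `I(Ω_m)_d = 0`,
`orbitVanishingIdeal_det_degree_eq_zero_of_forall_partition_card_le`), and some `λ₀ ⊢ m D` with
`ℓ(λ₀) ≤ m²` has `sk(λ₀, m×D) < a_{λ₀}(D[m])` (so a nonzero highest-weight vector of weight `λ₀^*`
lies in `I(Ω_m)_D`, `exists_hwv_mem_orbitVanishingIdeal_det_of_symKroneckerCoeffRect_lt` — BI13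
(5.2), Ikenmeyer 2012 (8.1.1); a weight pins the degree), then `I(Ω_m)` vanishes in every degree
`< D` and contains a nonzero form of degree `D`. For `m = 3`: `D = 10`, `λ₀ ∈ {(9,9,2⁶),
(12,5,2⁶,1), (13,3,2⁷)}` (`a = 1`, `sk = 0`, Ikenmeyer 2012 App. A.1) once the census certificates
for `d ≤ 9` are in hand. [cite: BurgisserIkenmeyer2013, §5 (5.2)] -/
theorem orbitVanishingIdeal_det_eq_zero_below_and_exists_of_symKroneckerCoeffRect_lt {m D : ℕ}
    [NeZero m]
    (H : ∀ d < D, ∀ lam : Nat.Partition (m * d), lam.parts.card ≤ m * m → lam.parts.card ≤ d →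
      plethysmCoeff k (MatIdx m) m (Weight.dualOfPartition (m * m) lam).toMatIdx ≤
        orbitMultiplicity k (detFormLex k m) m (Weight.dualOfPartition (m * m) lam).toMatIdx)
    (lam₀ : Nat.Partition (m * D)) (hlam₀ : lam₀.parts.card ≤ m * m)
    (hlt : symKroneckerCoeffRect k m D lam₀ <
      plethysmCoeff k (MatIdx m) m (Weight.dualOfPartition (m * m) lam₀).toMatIdx) :
    (∀ d < D, ∀ Ψ ∈ orbitVanishingIdeal (detFormLex k m) m, Ψ.IsHomogeneous d → Ψ = 0) ∧
    (∃ Ψ ∈ orbitVanishingIdeal (detFormLex k m) m, Ψ ≠ 0 ∧ Ψ.IsHomogeneous D) := by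
  haveI : Infinite k := CharZero.infinite k
  refine ⟨fun d hd Ψ hΨI hΨd =>
    orbitVanishingIdeal_det_degree_eq_zero_of_forall_partition_card_le (H d hd) hΨI hΨd, ?_⟩
  obtain ⟨F, hF0, hFH, hFI⟩ :=
    exists_hwv_mem_orbitVanishingIdeal_det_of_symKroneckerCoeffRect_lt lam₀ hlam₀ hlt
  exact ⟨F, hFI, hF0, isHomogeneous_of_mem_highestWeightSpace (NeZero.ne m) hFH
    (size_toMatIdx_dualOfPartition m lam₀ hlam₀)⟩

end MatIdx

/-! ### 6. Degree monotonicity of the ideal: the census is needed in the TOP degree only -/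

section Monotone

open MvPolynomial

variable {k : Type*} [Field k] {σ : Type*} [Fintype σ] [DecidableEq σ]

/-- **Emptiness of `I(GL · f)` in degree `d` descends to every degree `d' ≤ d`.** The vanishing
ideal `I(GL · f) ⊆ k[Sym^m]` is an ideal of an integral domain: if `0 ≠ Ψ ∈ I(GL · f)` were
homogeneous of degree `d' < d`, then `Ψ · X_e^{d-d'}` would be a nonzero homogeneous element of
degree `d` (any coordinate `X_e`; when there is no coordinate at all, `Ψ` is a constant vanishing at
the orbit point `f`, hence `0`). So a low-degree ideal census certifying `I(Δ_m[f])_d = 0` in ONE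
degree `d` certifies it in all degrees `≤ d`; the "minimal degree of `I(Δ_m[f])` is `D`" needs
certificates in degree `D - 1` only. [folklore] -/
theorem orbitVanishingIdeal_degree_eq_zero_of_le {f : MvPolynomial σ k} {m d d' : ℕ} (hd : d' ≤ d)
    (H : ∀ Ψ ∈ orbitVanishingIdeal f m, Ψ.IsHomogeneous d → Ψ = 0)
    {Ψ : MvPolynomial (DegIdx σ m) k} (hΨI : Ψ ∈ orbitVanishingIdeal f m)
    (hΨd : Ψ.IsHomogeneous d') : Ψ = 0 := by
  classical
  rcases isEmpty_or_nonempty (DegIdx σ m) with hE | ⟨⟨e⟩⟩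
  · -- no coordinates: `Ψ` is the constant `Ψ(f)`, and `Ψ` vanishes at the orbit point `f = 1 · f`
    have hΨ1 := (mem_orbitVanishingIdeal_iff.mp hΨI) 1
    rw [map_one, Module.End.one_apply, MvPolynomial.eq_C_of_isEmpty Ψ, aeval_C,
      Algebra.algebraMap_self, RingHom.id_apply] at hΨ1
    rw [MvPolynomial.eq_C_of_isEmpty Ψ, hΨ1, map_zero]
  · have hG : (X e ^ (d - d') : MvPolynomial (DegIdx σ m) k).IsHomogeneous (d - d') :=
      isHomogeneous_X_pow e (d - d')
    have hmem : Ψ * X e ^ (d - d') ∈ orbitVanishingIdeal f m := Ideal.mul_mem_right _ _ hΨI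
    have hhom : (Ψ * X e ^ (d - d')).IsHomogeneous d := by
      have h := hΨd.mul hG
      rwa [Nat.add_sub_cancel' hd] at h
    rcases mul_eq_zero.mp (H _ hmem hhom) with h | h
    · exact h
    · exact absurd h (pow_ne_zero _ (X_ne_zero e))

/-- **Below-`D` emptiness from degree `D - 1` alone**: if `I(GL · f)` has no nonzero homogeneous
element of degree `D - 1`, it has none of any degree `d < D`. [folklore] -/
theorem orbitVanishingIdeal_eq_zero_below_of_pred {f : MvPolynomial σ k} {m D : ℕ}
    (H : ∀ Ψ ∈ orbitVanishingIdeal f m, Ψ.IsHomogeneous (D - 1) → Ψ = 0) :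
    ∀ d < D, ∀ Ψ ∈ orbitVanishingIdeal f m, Ψ.IsHomogeneous d → Ψ = 0 :=
  fun _ hd _ hΨI hΨd => orbitVanishingIdeal_degree_eq_zero_of_le (Nat.le_sub_one_of_lt hd) H hΨI hΨd

end Monotone

section MatIdxMonotone

open MvPolynomial

variable {k : Type} [Field k] [CharZero k]

/-- **The packet sentence from the TOP-DEGREE census only** (sharpening of
`orbitVanishingIdeal_det_eq_zero_below_and_exists_of_symKroneckerCoeffRect_lt`). If for every
partition `λ ⊢ m (D-1)` with `ℓ(λ) ≤ min(m², D-1)` a det-side certificate gives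
`a_{λ*} ≤ mult_{λ*} k[Ω_m]_{D-1}` (so `I(Ω_m)_{D-1} = 0`, hence `I(Ω_m)_d = 0` for all `d < D` by
`orbitVanishingIdeal_degree_eq_zero_of_le`), and some `λ₀ ⊢ m D` with `ℓ(λ₀) ≤ m²` has
`sk(λ₀, m×D) < a_{λ₀}(D[m])`, then `I(Ω_m)` vanishes in every degree `< D` and contains a nonzero
form of degree `D`: its minimal degree is `D`. For `m = 3`, `D = 10`: the degree-`9` census
(797 types `λ ⊢ 27`, `ℓ(λ) ≤ 9`) and `λ₀ = (9,9,2⁶)` (`a = 1`, `sk = 0`, Ikenmeyer 2012 App. A.1,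
BI13 (5.2)) suffice; the censuses in degrees `≤ 8` are cross-checks, not hypotheses.
[cite: BurgisserIkenmeyer2013, §5 (5.2)] -/
theorem orbitVanishingIdeal_det_eq_zero_below_and_exists_of_pred_of_symKroneckerCoeffRect_lt
    {m D : ℕ} [NeZero m]
    (H : ∀ lam : Nat.Partition (m * (D - 1)), lam.parts.card ≤ m * m → lam.parts.card ≤ D - 1 →
      plethysmCoeff k (MatIdx m) m (Weight.dualOfPartition (m * m) lam).toMatIdx ≤
        orbitMultiplicity k (detFormLex k m) m (Weight.dualOfPartition (m * m) lam).toMatIdx)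
    (lam₀ : Nat.Partition (m * D)) (hlam₀ : lam₀.parts.card ≤ m * m)
    (hlt : symKroneckerCoeffRect k m D lam₀ <
      plethysmCoeff k (MatIdx m) m (Weight.dualOfPartition (m * m) lam₀).toMatIdx) :
    (∀ d < D, ∀ Ψ ∈ orbitVanishingIdeal (detFormLex k m) m, Ψ.IsHomogeneous d → Ψ = 0) ∧
    (∃ Ψ ∈ orbitVanishingIdeal (detFormLex k m) m, Ψ ≠ 0 ∧ Ψ.IsHomogeneous D) := by
  haveI : Infinite k := CharZero.infinite k
  refine ⟨orbitVanishingIdeal_eq_zero_below_of_pred fun Ψ hΨI hΨd =>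
    orbitVanishingIdeal_det_degree_eq_zero_of_forall_partition_card_le H hΨI hΨd, ?_⟩
  obtain ⟨F, hF0, hFH, hFI⟩ :=
    exists_hwv_mem_orbitVanishingIdeal_det_of_symKroneckerCoeffRect_lt lam₀ hlam₀ hlt
  exact ⟨F, hFI, hF0, isHomogeneous_of_mem_highestWeightSpace (NeZero.ne m) hFH
    (size_toMatIdx_dualOfPartition m lam₀ hlam₀)⟩

/-- **Per-side twin (Tranche 1c-ii) from the top degree only**: for the padded permanent
`z^{m-n} per_n` (`n ≤ m`), one per-side certificate `a ≤ r_per ≤ mult` per partition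
`λ ⊢ m (D-1)` with `ℓ(λ) ≤ min(m², D-1)` gives `I(Δ(z^{m-n} per_n))_d = 0` for EVERY `d < D`.
[cite: BLMW2011, (5.2.2)] -/
theorem orbitVanishingIdeal_paddedPer_eq_zero_below_of_pred {n m D : ℕ} [NeZero m] (hnm : n ≤ m)
    (H : ∀ lam : Nat.Partition (m * (D - 1)), lam.parts.card ≤ m * m → lam.parts.card ≤ D - 1 →
      plethysmCoeff k (MatIdx m) m (Weight.dualOfPartition (m * m) lam).toMatIdx ≤
        orbitMultiplicity k (paddedPerFormLex k n m) m (Weight.dualOfPartition (m * m) lam).toMatIdx) :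
    ∀ d < D, ∀ Ψ ∈ orbitVanishingIdeal (paddedPerFormLex k n m) m, Ψ.IsHomogeneous d → Ψ = 0 :=
  orbitVanishingIdeal_eq_zero_below_of_pred fun _ hΨI hΨd =>
    orbitVanishingIdeal_paddedPer_degree_eq_zero_of_forall_partition_card_le hnm H hΨI hΨd

end MatIdxMonotone

/-! ### 7. Non-emptiness ascends: the degrees carrying equations are exactly `d ≥ D` -/

section MinDegree

open MvPolynomial

variable {k : Type*} [Field k] {σ : Type*} [Fintype σ] [DecidableEq σ]

/-- **Non-emptiness of `I(GL · f)` in degree `d` ascends to every degree `d' ≥ d`** (multiply a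
nonzero homogeneous element by a power of a coordinate; `k[Sym^m]` is a domain). Together with
`orbitVanishingIdeal_degree_eq_zero_of_le`: the set of degrees in which `I(Δ_m[f])` has a nonzero
form is an upper set. [folklore] -/
theorem exists_ne_zero_mem_orbitVanishingIdeal_of_le
    {f : MvPolynomial σ k} {m d d' : ℕ} [Nonempty (DegIdx σ m)] (hd : d ≤ d')
    (hex : ∃ Ψ ∈ orbitVanishingIdeal f m, Ψ ≠ 0 ∧ Ψ.IsHomogeneous d) :
    ∃ Ψ ∈ orbitVanishingIdeal f m, Ψ ≠ 0 ∧ Ψ.IsHomogeneous d' := by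
  classical
  obtain ⟨e⟩ := ‹Nonempty (DegIdx σ m)›
  obtain ⟨Ψ, hΨI, hΨ0, hΨd⟩ := hex
  refine ⟨Ψ * X e ^ (d' - d), Ideal.mul_mem_right _ _ hΨI,
    mul_ne_zero hΨ0 (pow_ne_zero _ (X_ne_zero e)), ?_⟩
  have h := hΨd.mul (isHomogeneous_X_pow e (d' - d))
  rwa [Nat.add_sub_cancel' hd] at h

/-- **Minimal degree.** If `I(GL · f)` has no nonzero form of degree `< D` and has one of degree
`D`, then it has a nonzero form of degree `d` if and only if `D ≤ d`: "the minimal degree of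
`I(Δ_m[f])` is `D`" pins down the set of degrees carrying equations. [folklore] -/
theorem exists_ne_zero_mem_orbitVanishingIdeal_iff_le
    {f : MvPolynomial σ k} {m D : ℕ} [Nonempty (DegIdx σ m)]
    (hlow : ∀ d < D, ∀ Ψ ∈ orbitVanishingIdeal f m, Ψ.IsHomogeneous d → Ψ = 0)
    (hhigh : ∃ Ψ ∈ orbitVanishingIdeal f m, Ψ ≠ 0 ∧ Ψ.IsHomogeneous D) (d : ℕ) :
    (∃ Ψ ∈ orbitVanishingIdeal f m, Ψ ≠ 0 ∧ Ψ.IsHomogeneous d) ↔ D ≤ d := by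
  refine ⟨fun ⟨Ψ, hΨI, hΨ0, hΨd⟩ => ?_,
    fun hDd => exists_ne_zero_mem_orbitVanishingIdeal_of_le hDd hhigh⟩
  by_contra hlt
  exact hΨ0 (hlow d (not_le.mp hlt) Ψ hΨI hΨd)

end MinDegree

section MatIdxMinDegree

open MvPolynomial

variable {k : Type} [Field k] [CharZero k]

/-- The coordinate `X_{x_{(0,0)}^m}` exists: the index type of degree-`m` monomials in the `m²`
matrix variables is nonempty for `m ≠ 0`. [folklore] -/
theorem nonempty_degIdx_matIdx (m : ℕ) [NeZero m] : Nonempty (DegIdx (MatIdx m) m) :=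
  ⟨⟨Finsupp.single (toLex (⟨0, Nat.pos_of_ne_zero (NeZero.ne m)⟩,
      ⟨0, Nat.pos_of_ne_zero (NeZero.ne m)⟩)) m,
    mem_degMonomials_iff.mpr (Finsupp.degree_single _ _)⟩⟩

/-- **'The ideal of `Ω_m` has nonzero forms exactly in the degrees `≥ D`'** from the TOP-degree
census and one `sk < a` type in degree `D` (hypotheses of
`orbitVanishingIdeal_det_eq_zero_below_and_exists_of_pred_of_symKroneckerCoeffRect_lt`). For
`m = 3`: with the degree-`9` det-side census and `λ₀ = (9,9,2⁶)`, `I(Ω₃)_d ≠ 0 ⇔ d ≥ 10`.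
[cite: BurgisserIkenmeyer2013, §5 (5.2)] -/
theorem exists_ne_zero_mem_orbitVanishingIdeal_det_iff_le_of_pred_of_symKroneckerCoeffRect_lt
    {m D : ℕ} [NeZero m]
    (H : ∀ lam : Nat.Partition (m * (D - 1)), lam.parts.card ≤ m * m → lam.parts.card ≤ D - 1 →
      plethysmCoeff k (MatIdx m) m (Weight.dualOfPartition (m * m) lam).toMatIdx ≤
        orbitMultiplicity k (detFormLex k m) m (Weight.dualOfPartition (m * m) lam).toMatIdx)
    (lam₀ : Nat.Partition (m * D)) (hlam₀ : lam₀.parts.card ≤ m * m)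
    (hlt : symKroneckerCoeffRect k m D lam₀ <
      plethysmCoeff k (MatIdx m) m (Weight.dualOfPartition (m * m) lam₀).toMatIdx) (d : ℕ) :
    (∃ Ψ ∈ orbitVanishingIdeal (detFormLex k m) m, Ψ ≠ 0 ∧ Ψ.IsHomogeneous d) ↔ D ≤ d := by
  haveI := nonempty_degIdx_matIdx m
  obtain ⟨hlow, hhigh⟩ :=
    orbitVanishingIdeal_det_eq_zero_below_and_exists_of_pred_of_symKroneckerCoeffRect_lt H lam₀
      hlam₀ hlt
  exact exists_ne_zero_mem_orbitVanishingIdeal_iff_le hlow hhigh d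

end MatIdxMinDegree

end Literature.Computability.AlgebraicComplexity
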